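import Mathlib
import HarnessLib
import Summits.HubbardSuperconductivity.HubbardSuperconductivity.Theorems.KLProgrammeKLRegimeSplitPredicatesV2

/-!
# Producer (α) of 20437 v2, route (M) «near/far»: the ABSTRACT near/far inequality for fixed-tuple `L¹` sizes of sectorised kernels
# (cell gate-hubbard-kl, seat p1b g11 — 20437 registrant; (α-0) memo `ALPHA0-SCOPING-MEMO.md`, evidence on stmt-HubbardSuperconductivity-20437, pen (R59as))

The one open producer of the v2 engine skeleton is the single-iso-tuple line of the (E5-F)ₙ door (`isoTupleL1AtV17F_of_fixedTuple_le`, k3c2-p2):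
`fixedTupleL1 β 3 (klIsoKernelAt … K_n n m) Ω x₁ ≤ a·U + b·(Klam U)²` with `2a ≤ CF`.  Route (M) of the (α-0) memo reaches it from the VALUE hypothesis of
(E5-F)ₙ plus a per-tuple FIRST MOMENT, through an elementary inequality: a pinned position sum is at most (number of NEAR points) × (sup of the kernel) +
(first moment) / (radius), and the sup of a SECTORISED kernel is at most (product of the multipliers' momentum-space `ℓ¹` masses) × (sup of the momentum-space
kernel on the multipliers' support) — straight from the definition `sectorisedKernel … Ω x = Σ_k (Π_i F (Ω i) (k i) · planewave) · kernel …` and `‖planewave‖ = 1`.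
This module lands exactly that, model-free and currency-free (brick M1-abstract of the memo):

* §1 `sum_le_card_mul_add_moment_div` — near/far on a finite sum: `Σ f ≤ #{d < R}·S + (Σ d·f)/R` when `f ≤ S` on `{d < R}`.
* §2 `norm_sectorisedKernel_le_prod_l1_mul_sup` — `‖sectorisedKernel β F G m Ω x‖ ≤ (Π_i Σ_k ‖F (Ω i).1.1 k‖) · S` whenever the momentum-space kernel is `≤ S` in norm
  wherever every leg's multiplier is nonzero.
* §3 **`fixedTupleL1_le_nearFar`** — for a `4`-leg sectorised kernel pinned at `x₁`: `fixedTupleL1 β 3 (sectorisedKernel β F G 4) Ω x₁ ≤ ε³·Nr·(Π_i V_i)·S + M/R`, where `ε =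
  imagTimeWeight β M`, `Nr` bounds the number of free-leg position triples with every leg within `spaceTimeDist < R` of `x₁`, `V_i` bounds leg `i`'s multiplier mass, `S` the
  momentum-space kernel on the support, and `M` the pinned first moment `ε³ Σ_x (Σ_{j} spaceTimeDist (x j) x₁)·‖W Ω (x₁ :: x)‖` (the sum of the three (E4)-type pair moments).
* §4 `fixedTupleL1_klIsoKernelAt_le_nearFar` — §3 read on the (E5-F)ₙ object `klIsoKernelAt L M β U μ K n m = sectorisedKernel β (klIsoFamily … K klE0 m) (𝒱ₙ[K]) 4` (by `rfl`).
* §5 (appended) CONSERVATION-AWARE twins `norm_sectorisedKernel_le_prod_l1_mul_legSum`, `fixedTupleL1_le_nearFar_cons`, `fixedTupleL1_klIsoKernelAt_le_nearFar_cons`: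
  one distinguished leg's momentum is summed INSIDE the sup hypothesis, so a momentum-conserving kernel pays multiplier mass on THREE legs only (the fourth would
  cost a volume-dependent support count).

What the INSTANTIATION (memo M3/M4) must still supply: `Nr·Π V_i·(normalisation of S)` = O(ρ⁹) for `klIsoFamily` boxes of side ≍ Λ_m against near radius `R ≍ ρ·4^m` (duality
per leg and direction), `S` from the value hypothesis `B` of (E5-F)ₙ (+ the box-vs-ball Lipschitz step, itself a first moment), and `M` from the iso first-moment read-out
(E4-iso)ₙ.  Proofs only; no definitions; nothing about the model is asserted; nothing asserts superconductivity.  Reference: BGM 2006 §2.4 (2.52)/(2.71a)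
[cite: BenfattoGiulianiMastropietro2006].
-/

noncomputable section

namespace Summit.HubbardSuperconductivity.HubbardSuperconductivity.Theorems.EngineV8

set_option linter.dupNamespace false -- summit = problem name (single-conjunct summit), D-0017

open Real Finset Literature.MathematicalPhysics.QuantumLattice Literature.Probability.LatticeModels
open Summit.HubbardSuperconductivity.HubbardSuperconductivity.Theorems.KLRegimeSplit

/-! ## §1 Near/far on a finite sum -/

/-- **Near/far**: if `0 ≤ f`, `0 ≤ d`, `f i ≤ S` whenever `d i < R` (`R > 0`), then `Σ_s f ≤ #{i ∈ s | d i < R}·S + (Σ_s d·f)/R`. -/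
theorem sum_le_card_mul_add_moment_div {ι : Type*} (s : Finset ι) (f d : ι → ℝ) (hf : ∀ i ∈ s, 0 ≤ f i) (hd : ∀ i ∈ s, 0 ≤ d i)
    {R S : ℝ} (hR : 0 < R) (hS : ∀ i ∈ s, d i < R → f i ≤ S) :
    ∑ i ∈ s, f i ≤ ((s.filter fun i => d i < R).card : ℝ) * S + (∑ i ∈ s, d i * f i) / R := by
  classical
  rw [← sum_filter_add_sum_filter_not s (fun i => d i < R) f]
  refine add_le_add ?_ ?_
  · -- near: each term ≤ S
    have h : ∀ i ∈ s.filter (fun i => d i < R), f i ≤ S := fun i hi => hS i (mem_filter.1 hi).1 (mem_filter.1 hi).2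
    calc ∑ i ∈ s.filter (fun i => d i < R), f i ≤ ∑ _i ∈ s.filter (fun i => d i < R), S := sum_le_sum h
      _ = ((s.filter fun i => d i < R).card : ℝ) * S := by rw [sum_const, nsmul_eq_mul]
  · -- far: f i ≤ d i · f i / R since R ≤ d i
    rw [le_div_iff₀ hR, sum_mul]
    calc ∑ i ∈ s.filter (fun i => ¬ d i < R), f i * R ≤ ∑ i ∈ s.filter (fun i => ¬ d i < R), d i * f i :=
          sum_le_sum fun i hi => by
            have hfi := hf i (mem_filter.1 hi).1
            have hRi : R ≤ d i := le_of_not_gt (mem_filter.1 hi).2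
            calc f i * R ≤ f i * d i := mul_le_mul_of_nonneg_left hRi hfi
              _ = d i * f i := mul_comm _ _
      _ ≤ ∑ i ∈ s, d i * f i := sum_le_sum_of_subset_of_nonneg (filter_subset _ _) fun i hi _ => mul_nonneg (hd i hi) (hf i hi)

/-! ## §2 The sup of a sectorised kernel from its definition -/

section Sup

variable {L M : ℕ} [NeZero L]

/-- **Sup of a sectorised kernel**: from `sectorisedKernel … Ω x = Σ_k (Π_i F (Ω i).1.1 (k i) · planewave_i) · kernel …` and `‖planewave‖ = 1`, if the momentum-space
kernel is `≤ S` at every momentum assignment where all the legs' multipliers are nonzero, then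
`‖sectorisedKernel β F G m Ω x‖ ≤ (Π_i Σ_k ‖F (Ω i).1.1 k‖) · S`. -/
theorem norm_sectorisedKernel_le_prod_l1_mul_sup {N : ℕ} (β : ℝ) (F : Fin N → FreqMomentum L M → ℂ) (G : HubbardGrassmann L M) (m : ℕ)
    (Ω : Fin m → SectorLeg N) (x : Fin m → SpaceTimeIdx L M) {S : ℝ}
    (hS : ∀ k : Fin m → FreqMomentum L M, (∀ i, F (Ω i).1.1 (k i) ≠ 0) → ‖kernel ℂ G m (fun i => ((k i, (Ω i).1.2), (Ω i).2))‖ ≤ S) :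
    ‖sectorisedKernel L M β F G m Ω x‖ ≤ (∏ i, ∑ k : FreqMomentum L M, ‖F (Ω i).1.1 k‖) * S := by
  classical
  rw [sectorisedKernel_def]
  refine (norm_sum_le _ _).trans ?_
  have hterm : ∀ k : Fin m → FreqMomentum L M,
      ‖(∏ i, F (Ω i).1.1 (k i) * hubbardPlaneWave L M β (Ω i).2 (k i) (x i)) * kernel ℂ G m (fun i => ((k i, (Ω i).1.2), (Ω i).2))‖ ≤
        (∏ i, ‖F (Ω i).1.1 (k i)‖) * S := by
    intro k
    rw [norm_mul, norm_prod]
    have hprod : ∏ i, ‖F (Ω i).1.1 (k i) * hubbardPlaneWave L M β (Ω i).2 (k i) (x i)‖ = ∏ i, ‖F (Ω i).1.1 (k i)‖ :=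
      prod_congr rfl fun i _ => by rw [norm_mul, norm_hubbardPlaneWave, mul_one]
    rw [hprod]
    by_cases hk : ∃ i, F (Ω i).1.1 (k i) = 0
    · obtain ⟨i, hi⟩ := hk
      have h0 : ∏ i, ‖F (Ω i).1.1 (k i)‖ = 0 := prod_eq_zero (mem_univ i) (by rw [hi, norm_zero])
      rw [h0, zero_mul, zero_mul]
    · exact mul_le_mul_of_nonneg_left (hS k fun i hi => hk ⟨i, hi⟩) (prod_nonneg fun i _ => norm_nonneg _)
  refine (sum_le_sum fun k _ => hterm k).trans (le_of_eq ?_)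
  rw [← sum_mul, Fintype.prod_sum (fun i k => ‖F (Ω i).1.1 k‖)]

end Sup

/-! ## §3 The near/far inequality for fixed-tuple `L¹` sizes of four-leg sectorised kernels -/

section NearFar

variable {L M : ℕ} [NeZero L]

/-- **NEAR/FAR FOR `fixedTupleL1`** (brick M1-abstract of the (α-0) memo).  Four-leg sectorised kernel `W = sectorisedKernel β F G 4`, tuple `Ω`, pin `x₁`; `ε = imagTimeWeight β M`.
Hypotheses: the momentum-space kernel is `≤ S` on the tuple's multiplier support (`S ≥ 0`); leg `i`'s multiplier has momentum-space mass `Σ_k ‖F (Ω i).1.1 k‖ ≤ V i`; the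
number of free-leg position triples with EVERY leg within `spaceTimeDist < R` of the pin is `≤ Nr`; `R > 0`.  Conclusion:
`fixedTupleL1 β 3 W Ω x₁ ≤ ε³·Nr·(Π_i V i)·S + (ε³·Σ_x (Σ_j spaceTimeDist (x j) x₁)·‖W Ω (x₁ :: x)‖)/R` — near points pay the sup, far points pay the first moment. -/
theorem fixedTupleL1_le_nearFar {N : ℕ} (β : ℝ) (hβ : 0 ≤ β) (F : Fin N → FreqMomentum L M → ℂ) (G : HubbardGrassmann L M)
    (Ω : Fin 4 → SectorLeg N) (x₁ : SpaceTimeIdx L M) {S R Nr : ℝ} {V : Fin 4 → ℝ} (hS0 : 0 ≤ S) (hR : 0 < R)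
    (hS : ∀ k : Fin 4 → FreqMomentum L M, (∀ i, F (Ω i).1.1 (k i) ≠ 0) → ‖kernel ℂ G 4 (fun i => ((k i, (Ω i).1.2), (Ω i).2))‖ ≤ S)
    (hV : ∀ i, ∑ k : FreqMomentum L M, ‖F (Ω i).1.1 k‖ ≤ V i)
    (hNr : ((univ.filter fun x : Fin 3 → SpaceTimeIdx L M => ∀ j, spaceTimeDist L M β (x j) x₁ < R).card : ℝ) ≤ Nr) :
    fixedTupleL1 L M β 3 (sectorisedKernel L M β F G 4) Ω x₁ ≤
      imagTimeWeight β M ^ 3 * Nr * (∏ i, V i) * S +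
        imagTimeWeight β M ^ 3 * (∑ x : Fin 3 → SpaceTimeIdx L M,
          (∑ j, spaceTimeDist L M β (x j) x₁) * ‖sectorisedKernel L M β F G 4 Ω (Matrix.vecCons x₁ x)‖) / R := by
  classical
  have hε : 0 ≤ imagTimeWeight β M := by unfold imagTimeWeight; positivity
  have hε3 : 0 ≤ imagTimeWeight β M ^ 3 := pow_nonneg hε 3
  -- the sup bound at every position
  have hPV : (∏ i, ∑ k : FreqMomentum L M, ‖F (Ω i).1.1 k‖) ≤ ∏ i, V i :=
    prod_le_prod (fun i _ => sum_nonneg fun k _ => norm_nonneg _) fun i _ => hV i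
  have hV0 : 0 ≤ ∏ i, V i := le_trans (prod_nonneg fun i _ => sum_nonneg fun k _ => norm_nonneg _) hPV
  have hsup : ∀ x : Fin 3 → SpaceTimeIdx L M, ‖sectorisedKernel L M β F G 4 Ω (Matrix.vecCons x₁ x)‖ ≤ (∏ i, V i) * S := fun x =>
    (norm_sectorisedKernel_le_prod_l1_mul_sup β F G 4 Ω (Matrix.vecCons x₁ x) hS).trans (mul_le_mul_of_nonneg_right hPV hS0)
  -- distance to the pin: `d x := max_j dist (x j) x₁` would do; we use the SUM of the three distances (≥ each of them), which dominates the near test and is the (E4) currency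
  have hdist0 : ∀ (y : SpaceTimeIdx L M), 0 ≤ spaceTimeDist L M β y x₁ := fun y => by
    unfold spaceTimeDist
    exact le_max_of_le_right (le_max_of_le_left (Nat.cast_nonneg _))
  -- near/far on the position sum with `d x := Σ_j dist (x j) x₁`: `d x < R ⇒ ∀ j, dist (x j) x₁ < R`
  have hmain := sum_le_card_mul_add_moment_div (univ : Finset (Fin 3 → SpaceTimeIdx L M))
    (fun x => ‖sectorisedKernel L M β F G 4 Ω (Matrix.vecCons x₁ x)‖) (fun x => ∑ j, spaceTimeDist L M β (x j) x₁)
    (fun x _ => norm_nonneg _) (fun x _ => sum_nonneg fun j _ => hdist0 (x j)) hR (S := (∏ i, V i) * S) (fun x _ _ => hsup x)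
  -- the near set for `Σ_j dist < R` is inside the near set for `∀ j, dist < R`
  have hcard : ((univ.filter fun x : Fin 3 → SpaceTimeIdx L M => ∑ j, spaceTimeDist L M β (x j) x₁ < R).card : ℝ) ≤ Nr := by
    refine le_trans ?_ hNr
    exact_mod_cast card_le_card (fun x hx => by
      simp only [mem_filter, mem_univ, true_and] at hx ⊢
      exact fun j => lt_of_le_of_lt (single_le_sum (fun j _ => hdist0 (x j)) (mem_univ j)) hx)
  unfold fixedTupleL1
  calc imagTimeWeight β M ^ 3 * ∑ x : Fin 3 → SpaceTimeIdx L M, ‖sectorisedKernel L M β F G 4 Ω (Matrix.vecCons x₁ x)‖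
      ≤ imagTimeWeight β M ^ 3 * (((univ.filter fun x : Fin 3 → SpaceTimeIdx L M => ∑ j, spaceTimeDist L M β (x j) x₁ < R).card : ℝ) * ((∏ i, V i) * S) +
          (∑ x : Fin 3 → SpaceTimeIdx L M, (∑ j, spaceTimeDist L M β (x j) x₁) * ‖sectorisedKernel L M β F G 4 Ω (Matrix.vecCons x₁ x)‖) / R) :=
        mul_le_mul_of_nonneg_left hmain hε3
    _ ≤ imagTimeWeight β M ^ 3 * (Nr * ((∏ i, V i) * S) +
          (∑ x : Fin 3 → SpaceTimeIdx L M, (∑ j, spaceTimeDist L M β (x j) x₁) * ‖sectorisedKernel L M β F G 4 Ω (Matrix.vecCons x₁ x)‖) / R) := by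
        exact mul_le_mul_of_nonneg_left (add_le_add (mul_le_mul_of_nonneg_right hcard (mul_nonneg hV0 hS0)) le_rfl) hε3
    _ = _ := by ring

/-! ## §4 The same on the (E5-F)ₙ object `klIsoKernelAt` -/

open Summit.HubbardSuperconductivity.HubbardSuperconductivity.Theorems.KLProgrammeLegKernels in
/-- **Near/far for the scale-`n` quartic kernel at isotropic resolution `m`** — `fixedTupleL1_le_nearFar` with `F := klIsoFamily L M β μ K klE0 m`,
`G := klEffectiveAction L M β U μ K klE0 n` (`klIsoKernelAt` unfolds to exactly this sectorised kernel): the single-iso-tuple size of the (E5-F)ₙ door is at most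
(near count) × (multiplier masses) × (momentum-space sup on the tuple's support) + (pinned first moment)/R. -/
theorem fixedTupleL1_klIsoKernelAt_le_nearFar [NeZero M] (β : ℝ) (hβ : 0 ≤ β) (U μ : ℝ) (K : TrigPolyC4v) (n m : ℕ)
    (Ω : Fin 4 → SectorLeg (sectorCount (2 * m))) (x₁ : SpaceTimeIdx L M) {S R Nr : ℝ} {V : Fin 4 → ℝ} (hS0 : 0 ≤ S) (hR : 0 < R)
    (hS : ∀ k : Fin 4 → FreqMomentum L M, (∀ i, klIsoFamily L M β μ K klE0 m (Ω i).1.1 (k i) ≠ 0) →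
      ‖kernel ℂ (klEffectiveAction L M β U μ K klE0 n) 4 (fun i => ((k i, (Ω i).1.2), (Ω i).2))‖ ≤ S)
    (hV : ∀ i, ∑ k : FreqMomentum L M, ‖klIsoFamily L M β μ K klE0 m (Ω i).1.1 k‖ ≤ V i)
    (hNr : ((univ.filter fun x : Fin 3 → SpaceTimeIdx L M => ∀ j, spaceTimeDist L M β (x j) x₁ < R).card : ℝ) ≤ Nr) :
    fixedTupleL1 L M β 3 (klIsoKernelAt L M β U μ K n m) Ω x₁ ≤
      imagTimeWeight β M ^ 3 * Nr * (∏ i, V i) * S +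
        imagTimeWeight β M ^ 3 * (∑ x : Fin 3 → SpaceTimeIdx L M,
          (∑ j, spaceTimeDist L M β (x j) x₁) * ‖klIsoKernelAt L M β U μ K n m Ω (Matrix.vecCons x₁ x)‖) / R :=
  fixedTupleL1_le_nearFar β hβ (klIsoFamily L M β μ K klE0 m) (klEffectiveAction L M β U μ K klE0 n) Ω x₁ hS0 hR hS hV hNr

end NearFar

/-! ## §5 Conservation-aware versions: the multiplier mass of ONE leg is not paid -/

section Cons

variable {L M : ℕ} [NeZero L]

/-- **Sup of a sectorised kernel, one leg summed inside** (`m = n + 1` legs, distinguished leg `i₀`): if for every assignment `k'` of the OTHER legs' momenta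
`Σ_q ‖F (Ω i₀).1.1 q‖·‖kernel … (k' with q at i₀)‖ ≤ S` (for a momentum-conserving kernel this is ONE nonzero term, `≤ sup ‖kernel‖` since `‖F‖ ≤ 1` needs no mass),
then `‖sectorisedKernel β F G (n+1) Ω x‖ ≤ (Π_{j : Fin n} Σ_k ‖F (Ω (i₀.succAbove j)).1.1 k‖) · S` — only the `n` other legs pay their multiplier mass. -/
theorem norm_sectorisedKernel_le_prod_l1_mul_legSum {N n : ℕ} (β : ℝ) (F : Fin N → FreqMomentum L M → ℂ) (G : HubbardGrassmann L M)
    (Ω : Fin (n + 1) → SectorLeg N) (x : Fin (n + 1) → SpaceTimeIdx L M) (i₀ : Fin (n + 1)) {S : ℝ}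
    (hS : ∀ k' : Fin n → FreqMomentum L M,
      ∑ q : FreqMomentum L M, ‖F (Ω i₀).1.1 q‖ * ‖kernel ℂ G (n + 1) (fun i => ((Fin.insertNth (α := fun _ : Fin (n + 1) => FreqMomentum L M) i₀ q k' i, (Ω i).1.2), (Ω i).2))‖ ≤ S) :
    ‖sectorisedKernel L M β F G (n + 1) Ω x‖ ≤ (∏ j : Fin n, ∑ k : FreqMomentum L M, ‖F (Ω (i₀.succAbove j)).1.1 k‖) * S := by
  classical
  rw [sectorisedKernel_def]
  refine (norm_sum_le _ _).trans ?_
  -- termwise: ‖(Π F·pw)·kernel‖ = (Π_{j} ‖F_{succAbove j}‖) · (‖F_{i₀}(k i₀)‖·‖kernel k‖)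
  have hterm : ∀ k : Fin (n + 1) → FreqMomentum L M,
      ‖(∏ i, F (Ω i).1.1 (k i) * hubbardPlaneWave L M β (Ω i).2 (k i) (x i)) * kernel ℂ G (n + 1) (fun i => ((k i, (Ω i).1.2), (Ω i).2))‖ =
        (∏ j : Fin n, ‖F (Ω (i₀.succAbove j)).1.1 (k (i₀.succAbove j))‖) *
          (‖F (Ω i₀).1.1 (k i₀)‖ * ‖kernel ℂ G (n + 1) (fun i => ((k i, (Ω i).1.2), (Ω i).2))‖) := by
    intro k
    rw [norm_mul, norm_prod, Fin.prod_univ_succAbove _ i₀]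
    simp only [norm_mul, norm_hubbardPlaneWave, mul_one]
    ring
  simp_rw [hterm]
  -- re-index the sum over `k` by `(k i₀, k ∘ succAbove)` and sum the `i₀` coordinate first
  rw [← (Fin.insertNthEquiv (fun _ => FreqMomentum L M) i₀).sum_comp]
  simp only [Fin.insertNthEquiv_apply, Fin.insertNth_apply_same, Fin.insertNth_apply_succAbove]
  rw [Fintype.sum_prod_type_right]
  -- now: Σ_{k'} Σ_q (Π_j ‖F (k' j)‖)·(‖F q‖·‖kernel (insertNth q k')‖) ≤ (Π_j Σ ‖F‖)·S
  calc ∑ k' : Fin n → FreqMomentum L M, ∑ q : FreqMomentum L M,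
        (∏ j : Fin n, ‖F (Ω (i₀.succAbove j)).1.1 (k' j)‖) *
          (‖F (Ω i₀).1.1 q‖ * ‖kernel ℂ G (n + 1) (fun i => ((Fin.insertNth (α := fun _ : Fin (n + 1) => FreqMomentum L M) i₀ q k' i, (Ω i).1.2), (Ω i).2))‖)
      = ∑ k' : Fin n → FreqMomentum L M, (∏ j : Fin n, ‖F (Ω (i₀.succAbove j)).1.1 (k' j)‖) *
          ∑ q : FreqMomentum L M, ‖F (Ω i₀).1.1 q‖ * ‖kernel ℂ G (n + 1) (fun i => ((Fin.insertNth (α := fun _ : Fin (n + 1) => FreqMomentum L M) i₀ q k' i, (Ω i).1.2), (Ω i).2))‖ := by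
        simp_rw [mul_sum]
    _ ≤ ∑ k' : Fin n → FreqMomentum L M, (∏ j : Fin n, ‖F (Ω (i₀.succAbove j)).1.1 (k' j)‖) * S :=
        sum_le_sum fun k' _ => mul_le_mul_of_nonneg_left (hS k') (prod_nonneg fun j _ => norm_nonneg _)
    _ = (∏ j : Fin n, ∑ k : FreqMomentum L M, ‖F (Ω (i₀.succAbove j)).1.1 k‖) * S := by
        rw [← sum_mul, Fintype.prod_sum (fun j k => ‖F (Ω (i₀.succAbove j)).1.1 k‖)]

/-- **NEAR/FAR FOR `fixedTupleL1`, conservation-aware** (four legs, distinguished leg `i₀` whose momentum is summed INSIDE the sup hypothesis, so that a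
momentum-conserving kernel pays NO multiplier mass on that leg): `fixedTupleL1 β 3 W Ω x₁ ≤ ε³·Nr·(Π_{j : Fin 3} V j)·S + (pinned first moment)/R`, with `V j` the masses of
the three legs `i₀.succAbove j` and `S` a bound on `Σ_q ‖F (Ω i₀) q‖·‖kernel (… q at i₀ …)‖` uniformly in the other legs' momenta. -/
theorem fixedTupleL1_le_nearFar_cons {N : ℕ} (β : ℝ) (hβ : 0 ≤ β) (F : Fin N → FreqMomentum L M → ℂ) (G : HubbardGrassmann L M)
    (Ω : Fin 4 → SectorLeg N) (x₁ : SpaceTimeIdx L M) (i₀ : Fin 4) {S R Nr : ℝ} {V : Fin 3 → ℝ} (hS0 : 0 ≤ S) (hR : 0 < R)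
    (hS : ∀ k' : Fin 3 → FreqMomentum L M,
      ∑ q : FreqMomentum L M, ‖F (Ω i₀).1.1 q‖ * ‖kernel ℂ G 4 (fun i => ((Fin.insertNth (α := fun _ : Fin (3 + 1) => FreqMomentum L M) i₀ q k' i, (Ω i).1.2), (Ω i).2))‖ ≤ S)
    (hV : ∀ j : Fin 3, ∑ k : FreqMomentum L M, ‖F (Ω (i₀.succAbove j)).1.1 k‖ ≤ V j)
    (hNr : ((univ.filter fun x : Fin 3 → SpaceTimeIdx L M => ∀ j, spaceTimeDist L M β (x j) x₁ < R).card : ℝ) ≤ Nr) :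
    fixedTupleL1 L M β 3 (sectorisedKernel L M β F G 4) Ω x₁ ≤
      imagTimeWeight β M ^ 3 * Nr * (∏ j, V j) * S +
        imagTimeWeight β M ^ 3 * (∑ x : Fin 3 → SpaceTimeIdx L M,
          (∑ j, spaceTimeDist L M β (x j) x₁) * ‖sectorisedKernel L M β F G 4 Ω (Matrix.vecCons x₁ x)‖) / R := by
  classical
  have hε3 : 0 ≤ imagTimeWeight β M ^ 3 := pow_nonneg (by unfold imagTimeWeight; positivity) 3
  have hPV : (∏ j : Fin 3, ∑ k : FreqMomentum L M, ‖F (Ω (i₀.succAbove j)).1.1 k‖) ≤ ∏ j, V j :=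
    prod_le_prod (fun j _ => sum_nonneg fun k _ => norm_nonneg _) fun j _ => hV j
  have hV0 : 0 ≤ ∏ j, V j := le_trans (prod_nonneg fun j _ => sum_nonneg fun k _ => norm_nonneg _) hPV
  have hsup : ∀ x : Fin 3 → SpaceTimeIdx L M, ‖sectorisedKernel L M β F G 4 Ω (Matrix.vecCons x₁ x)‖ ≤ (∏ j, V j) * S := fun x =>
    (norm_sectorisedKernel_le_prod_l1_mul_legSum β F G Ω (Matrix.vecCons x₁ x) i₀ hS).trans (mul_le_mul_of_nonneg_right hPV hS0)
  have hdist0 : ∀ y : SpaceTimeIdx L M, 0 ≤ spaceTimeDist L M β y x₁ := fun y => by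
    unfold spaceTimeDist
    exact le_max_of_le_right (le_max_of_le_left (Nat.cast_nonneg _))
  have hmain := sum_le_card_mul_add_moment_div (univ : Finset (Fin 3 → SpaceTimeIdx L M))
    (fun x => ‖sectorisedKernel L M β F G 4 Ω (Matrix.vecCons x₁ x)‖) (fun x => ∑ j, spaceTimeDist L M β (x j) x₁)
    (fun x _ => norm_nonneg _) (fun x _ => sum_nonneg fun j _ => hdist0 (x j)) hR (S := (∏ j, V j) * S) (fun x _ _ => hsup x)
  have hcard : ((univ.filter fun x : Fin 3 → SpaceTimeIdx L M => ∑ j, spaceTimeDist L M β (x j) x₁ < R).card : ℝ) ≤ Nr := by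
    refine le_trans ?_ hNr
    exact_mod_cast card_le_card (fun x hx => by
      simp only [mem_filter, mem_univ, true_and] at hx ⊢
      exact fun j => lt_of_le_of_lt (single_le_sum (fun j _ => hdist0 (x j)) (mem_univ j)) hx)
  unfold fixedTupleL1
  calc imagTimeWeight β M ^ 3 * ∑ x : Fin 3 → SpaceTimeIdx L M, ‖sectorisedKernel L M β F G 4 Ω (Matrix.vecCons x₁ x)‖
      ≤ imagTimeWeight β M ^ 3 * (((univ.filter fun x : Fin 3 → SpaceTimeIdx L M => ∑ j, spaceTimeDist L M β (x j) x₁ < R).card : ℝ) * ((∏ j, V j) * S) +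
          (∑ x : Fin 3 → SpaceTimeIdx L M, (∑ j, spaceTimeDist L M β (x j) x₁) * ‖sectorisedKernel L M β F G 4 Ω (Matrix.vecCons x₁ x)‖) / R) :=
        mul_le_mul_of_nonneg_left hmain hε3
    _ ≤ imagTimeWeight β M ^ 3 * (Nr * ((∏ j, V j) * S) +
          (∑ x : Fin 3 → SpaceTimeIdx L M, (∑ j, spaceTimeDist L M β (x j) x₁) * ‖sectorisedKernel L M β F G 4 Ω (Matrix.vecCons x₁ x)‖) / R) := by
        exact mul_le_mul_of_nonneg_left (add_le_add (mul_le_mul_of_nonneg_right hcard (mul_nonneg hV0 hS0)) le_rfl) hε3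
    _ = _ := by ring

open Summit.HubbardSuperconductivity.HubbardSuperconductivity.Theorems.KLProgrammeLegKernels in
/-- The conservation-aware near/far read on the (E5-F)ₙ object `klIsoKernelAt` (cf. `fixedTupleL1_klIsoKernelAt_le_nearFar`). -/
theorem fixedTupleL1_klIsoKernelAt_le_nearFar_cons [NeZero M] (β : ℝ) (hβ : 0 ≤ β) (U μ : ℝ) (K : TrigPolyC4v) (n m : ℕ)
    (Ω : Fin 4 → SectorLeg (sectorCount (2 * m))) (x₁ : SpaceTimeIdx L M) (i₀ : Fin 4) {S R Nr : ℝ} {V : Fin 3 → ℝ} (hS0 : 0 ≤ S) (hR : 0 < R)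
    (hS : ∀ k' : Fin 3 → FreqMomentum L M,
      ∑ q : FreqMomentum L M, ‖klIsoFamily L M β μ K klE0 m (Ω i₀).1.1 q‖ *
        ‖kernel ℂ (klEffectiveAction L M β U μ K klE0 n) 4
          (fun i => ((Fin.insertNth (α := fun _ : Fin (3 + 1) => FreqMomentum L M) i₀ q k' i, (Ω i).1.2), (Ω i).2))‖ ≤ S)
    (hV : ∀ j : Fin 3, ∑ k : FreqMomentum L M, ‖klIsoFamily L M β μ K klE0 m (Ω (i₀.succAbove j)).1.1 k‖ ≤ V j)
    (hNr : ((univ.filter fun x : Fin 3 → SpaceTimeIdx L M => ∀ j, spaceTimeDist L M β (x j) x₁ < R).card : ℝ) ≤ Nr) :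
    fixedTupleL1 L M β 3 (klIsoKernelAt L M β U μ K n m) Ω x₁ ≤
      imagTimeWeight β M ^ 3 * Nr * (∏ j, V j) * S +
        imagTimeWeight β M ^ 3 * (∑ x : Fin 3 → SpaceTimeIdx L M,
          (∑ j, spaceTimeDist L M β (x j) x₁) * ‖klIsoKernelAt L M β U μ K n m Ω (Matrix.vecCons x₁ x)‖) / R :=
  fixedTupleL1_le_nearFar_cons β hβ (klIsoFamily L M β μ K klE0 m) (klEffectiveAction L M β U μ K klE0 n) Ω x₁ i₀ hS0 hR hS hV hNr

end Cons

end Summit.HubbardSuperconductivity.HubbardSuperconductivity.Theorems.EngineV8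

end
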